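import Summits.BirchSwinnertonDyer.BirchSwinnertonDyer.Theorems.AdditiveBranchIMCMultLowerCycLineLeadingCoeff
import Summits.BirchSwinnertonDyer.Rank1Residual.Additive.DisegniLineGrossZagier
import Summits.BirchSwinnertonDyer.Rank1Residual.AdditivePotMult.PotMultBranchPAdicGrossZagier
import HarnessLib

/-!
# Route `AdditiveBranchIMC` (rung K1), crux `MultLower` (item 19359), cell (M): the KERNEL (M) twin of
# gz's STEP C(2) — the twisted-branch `p`-adic Gross–Zagier identity at a MULTIPLICATIVE twist model
# `(V, f, ϖ)` from Disegni's clauses, EVEN branch (`p ≡ 1 (mod 4)`)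

Cell `bsd-addord`, seat `bsd-addord-k1-c4` (gen 4). THEOREMS ONLY (no definition, no named fact, no
`sorry`). The (M) twin of gz's `DisegniLineGrossZagier.lean` (`branchPAdicGrossZagier_identity_of_cycLine`,
p412307): for `E = W` additive at `p ≡ 1 (mod 4)` of analytic rank one, `C • V^{(p)} = W` with `V`
MULTIPLICATIVE at `p` (`a = a_p(V) = ±1`, newform `f`, `ϖ·Ω_V = Ω⁺_f`), a quadratic `K` (character `κ`,
`p ∤ d_K`, `rank E^{(d_K)}(ℚ) = 0`), the multiplicative twist `V′ ≅ V ⊗ κ` (`a_p(V′) = a_p(V)`, newform `f′`,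
`∑(a/p)[a/p]⁺_{f′} ≠ 0`), the newform `f_E` of `E`, and height data `Dh`, `DhK` (restriction factor `1`)
carrying Disegni's clauses `CycLineGrossZagierClauses W K ι f_E a DhK`:

  `∃ u ∈ ℤ_p^×, q ∈ ℚ:  L′(E,1) = q·Ω_E·Reg_∞(E)  ∧  ϖ·[T¹]L⁺_p(f, a, ω^{(p−1)/2}, T)·log_p γ = u·q·Reg_p(E,Dh)`

(`branchPAdicGrossZagierMult_identity_of_cycLine`) — the (M) EVEN clause of hFact's
`TwistedBranchGrossZagierAt` / of the typed `BranchPAdicGrossZagierMultAt`, DERIVED. The computation is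
gz's verbatim (`arch_algebra`, `padic_algebra` are imported): the archimedean side
(`archRatioClause_rational_semistable` = gz's `archRatioClause_rational` with `GoodOrd V p` weakened to
`Good V p ∨ Mult V p`, which is all Pal 2012 Thm. 3.2 and Birch need) and the `p`-adic side
(`padicRatioClause_identity_mult`: `Z° = u·p·a⁻²` with `a = ±1`, so the unit is `±a⁻¹ = ±1`), over STEP
B(2) on (M) (`coeff_one_cycLine_eq_mult`). Inputs displayed as hypotheses (all PUBLISHED; `hArt` is now
the tree THEOREM `rankinSelbergEulerProductHecke_baseChangeDirichlet_eq_holds`, kept as a binder for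
uniformity with gz): `hArt`, `h73` (GZ86 I.(7.3)), `hPal`, `hmod`, `hGZK`.

References: [Disegni2017] Thm. A/B, (1.1.3); [GrossZagier1986] Thm. I.(7.3); [Pal2012] Thm. 3.2;
[MazurTateTeitelbaum1986Invent] §I.8, §I.10 (10.1), §I.13–I.14; gz's memo HOME/proof/PROOF-gz-kernel.md §3.
-/

set_option autoImplicit false
set_option linter.dupNamespace false

noncomputable section

open scoped Classical MatrixGroups ModularForm NumberField

namespace Summit.BirchSwinnertonDyer.BirchSwinnertonDyer.Theorems.AdditiveBranchIMCMultLower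

open CongruenceSubgroup WeierstrassCurve NumberField Literature.NumberTheory.EllipticCurves
  Literature.NumberTheory.EllipticCurves.ModularForms Literature.NumberTheory.EllipticCurves.Rank1Residual
  Literature.NumberTheory.EllipticCurves.Disegni2017 Literature.NumberTheory.QuadraticFields
  Literature.NumberTheory.GaloisRepresentations
  Summit.BirchSwinnertonDyer.Rank1Residual.Additive
  Summit.BirchSwinnertonDyer.Rank1Residual.AdditivePotMult

section Identity

variable {W : WeierstrassCurve ℚ} [W.IsElliptic] [W.IsGloballyMinimal] {p : ℕ} [hp : Fact p.Prime]
  (ι : PadicAlgCl p ≃+* ℂ) (K : Type) [Field K] [NumberField K] [IsGalois ℚ K]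

/-! ### §1 Sign bookkeeping for `a_p(V) = ±1` -/

/-- **`a_p(V)⁻¹` is (the image of) a unit of `ℤ_p`** for `V` multiplicative at `p` (`a_p = ±1`, so
`a_p⁻¹ = a_p = ±1`). [cite: MazurTateTeitelbaum1986Invent, §I.10 (allowable root at p ∣ N)] -/
theorem exists_unit_coe_eq_inv_multRoot (V : WeierstrassCurve ℚ) [V.IsElliptic] [V.IsGloballyMinimal]
    (hV : Mult V p) {N : ℕ} [NeZero N] {g : CuspForm (Gamma0 N) 2} (hg : IsNewformOf V g) :
    ∃ u₀ : ℤ_[p]ˣ, ((u₀ : ℤ_[p]) : ℚ_[p]) = (((V.LFunction p : ℤ) : ℚ_[p]))⁻¹ := by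
  obtain ⟨h1 | h1, -⟩ := LFunction_eq_or_eq_neg_and_dvd_level_of_mult V hV hg
  · exact ⟨1, by rw [h1]; simp⟩
  · exact ⟨-1, by rw [h1, Units.val_neg, PadicInt.coe_neg, Units.val_one, PadicInt.coe_one]; norm_num⟩

/-- **In analytic rank one the even one-term branch of the multiplicative twist vanishes at `T = 0`**
(`p ≡ 1 (mod 4)`): `L⁺_p(f, a_p, ω^{(p−1)/2}, 0) = a_p⁻¹∑(a/p)[a/p]⁺_f` and `L(E,1) = 0` kills the sum
(Birch; the tree's `constantCoeff_multBranch_eq_zero_of_analyticRank_eq_one` read at the even parity and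
the sign `a_p`). [cite: MazurTateTeitelbaum1986Invent, §I.8, §I.13–I.14] -/
theorem constantCoeff_plusBranchMult_eq_zero_of_analyticRank_eq_one (hmod : hasEntireLFunction_rat)
    (hadd : Addv W p) (hr : W.analyticRank = 1) (hp4 : p % 4 = 1)
    (V : WeierstrassCurve ℚ) [V.IsElliptic] [V.IsGloballyMinimal] (C : VariableChange ℚ)
    (hC : C • V.quadraticTwist (p : ℚ) = W) (hV : Mult V p)
    {N : ℕ} [NeZero N] {f : CuspForm (Gamma0 N) 2} (hf : IsNewformOf V f)
    (ϖ : ℚ) (hϖ : (ϖ : ℝ) * V.realPeriodRat = plusPeriod f) :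
    PowerSeries.constantCoeff (padicLFunctionPlusBranchMult f ((V.LFunction p : ℤ) : ℚ_[p]) (p / 2)) = 0 := by
  have hp2 : p ≠ 2 := by omega
  have heven : Even (p / 2) := ⟨p / 4, by omega⟩
  have hC' : C • V.quadraticTwist ((-1 : ℚ) ^ (p / 2) * p) = W := by
    rw [pStar_eq_self_of_mod_four_eq_one hp4]; exact hC
  have hϖ' : if Even (p / 2) then (ϖ : ℝ) * V.realPeriodRat = plusPeriod f
      else (ϖ : ℝ) * V.imaginaryPeriodRat = minusPeriod f := by rw [if_pos heven]; exact hϖ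
  by_cases hs : V.HasSplitMultiplicativeReductionAtPrime p
  · have ha : ((V.LFunction p : ℤ) : ℚ_[p]) = 1 := by
      have h1 := (hf.cuspCoeff_eq_one_and_sq_of_split hs).1
      rw [hf.2 p] at h1
      have h1' : (V.LFunction p : ℤ) = 1 := by exact_mod_cast h1
      rw [h1']; push_cast; rfl
    have h := constantCoeff_multBranch_eq_zero_of_analyticRank_eq_one W p hmod hadd hr hp2 V C hC' hf
      _ (Or.inl ⟨hs, rfl⟩) ϖ hϖ'
    rw [if_pos heven] at h
    rw [ha]; exact h
  · have ha : ((V.LFunction p : ℤ) : ℚ_[p]) = -1 := by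
      have h1 := (hf.cuspCoeff_eq_neg_one_and_dvd_of_nonsplit hV hs).1
      rw [hf.2 p] at h1
      have h1' : (V.LFunction p : ℤ) = -1 := by exact_mod_cast h1
      rw [h1']; push_cast; rfl
    have h := constantCoeff_multBranch_eq_zero_of_analyticRank_eq_one W p hmod hadd hr hp2 V C hC' hf
      _ (Or.inr ⟨hV, hs, rfl⟩) ϖ hϖ'
    rw [if_pos heven] at h
    rw [ha]; exact h

/-! ### §2 STEP C(2a): the archimedean side (semistable `V`: good OR multiplicative at `p`) -/

/-- **STEP C(2a) — the archimedean side: Disegni's (1.1.3)-clause makes `u·Car·Ω⁺_f·Ω⁺_{f′}` rational**, for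
`V` good OR multiplicative at `p` (gz's `archRatioClause_rational` verbatim with `GoodOrd V p` weakened to
`Good V p ∨ Mult V p` — Pal 2012 Thm. 3.2 needs only semistability of `V` at `p`). With the Artin formalism,
the continuation of `L(f_E × 𝟙_K, s)` is `L(E,s)·L₂(s)`, `L₂` continuing `L(f′, χ_p, s)`; `L(E,1) = 0`,
`L′(E,1) = c·Ω_E·R`, Birch `S′Ω⁺_{f′} = τ(χ_p)L₂(1)`, `τ² = p`, Pal `Ω⁺_f = ϖ√pΩ_E` give `ρ ≠ 0` and
`u·Car·Ω⁺_f·Ω⁺_{f′} = ε·2uϖρp/(qcS′)`. [cite: Disegni2017, (1.1.3)–(1.1.4) (arXiv v3 PDF pp. 4–5)]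
[cite: Pal2012, Thm. 3.2] [cite: MazurTateTeitelbaum1986Invent, §I.8 (8.6)] -/
theorem archRatioClause_rational_semistable (hp4 : p % 4 = 1)
    (hArt : rankinSelbergEulerProductHecke_baseChangeDirichlet_eq)
    (hPal : Pal2012.thm32_sqrt_mul_realPeriodRat_twist_eq_of_prime_one_mod_four)
    (hmod : hasEntireLFunction_rat)
    (h2 : Module.finrank ℚ K = 2) (κ : DirichletCharacter ℂ (NumberField.discr K).natAbs)
    (hκ : ∀ ℓ : ℕ, ℓ.Prime → ℓ ≠ 2 → κ ℓ = (jacobiSym (NumberField.discr K) ℓ : ℂ))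
    (hκ2 : κ 2 = if NumberField.discr K % 8 = 1 then 1
        else if NumberField.discr K % 8 = 5 then -1 else 0)
    (hadd : Addv W p) (hr : W.analyticRank = 1)
    (V V' : WeierstrassCurve ℚ) [V.IsElliptic] [V.IsGloballyMinimal] [V'.IsElliptic] [V'.IsGloballyMinimal]
    (hVW : ∃ C : VariableChange ℚ, C • V.quadraticTwist (p : ℚ) = W) (hsemi : Good V p ∨ Mult V p)
    {N NE N' : ℕ} [NeZero N] [NeZero NE] [NeZero N'] {f : CuspForm (Gamma0 N) 2}
    {fE : CuspForm (Gamma0 NE) 2} {f' : CuspForm (Gamma0 N') 2}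
    (hfV : IsNewformOf V f) (hfE : IsNewformOf W fE) (hfV' : IsNewformOf V' f')
    (hV' : ∀ n : ℕ, cuspCoeff f' n = κ (n : ZMod (NumberField.discr K).natAbs) * cuspCoeff f n)
    (hS' : legendrePlusSymbolSum f' p ≠ 0)
    (ϖ : ℚ) (hϖ : (ϖ : ℝ) * V.realPeriodRat = plusPeriod f)
    {c : ℚ} (hc : c ≠ 0)
    (hcL : deriv W.entireLFunction 1 = (((c : ℝ) * W.realPeriodRat * W.regulator : ℝ) : ℂ))
    {Car : ℝ} (hCar : 0 < Car) {P₁ P₂ : (W.baseChange K).toAffine.Point} {q ρ : ℚ} (hq : q ≠ 0)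
    (hArch : ArchRatioClause W K fE Car P₁ P₂ q)
    (hρR : (P₁.heightPairing P₂ : ℝ) = (ρ : ℝ) * (2 : ℕ) * W.regulator) :
    ρ ≠ 0 ∧ ∃ ε : ℚ, (ε = 1 ∨ ε = -1) ∧
      (splitLocalConstant p : ℂ) * (Car : ℂ) * (plusPeriod f : ℂ) * (plusPeriod f' : ℂ) =
        ((ε * (2 * splitLocalConstant p * ϖ * ρ * p / (q * c * legendrePlusSymbolSum f' p)) : ℚ) : ℂ) := by
  haveI : NeZero p := ⟨hp.out.ne_zero⟩
  haveI : NeZero (NumberField.discr K).natAbs :=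
    ⟨Int.natAbs_ne_zero.mpr (NumberField.discr_ne_zero K)⟩
  have hpP : p.Prime := hp.out
  have hp2 : p ≠ 2 := by omega
  have hEnt : W.HasEntireLFunction := hmod W
  -- the coefficient relation `a_n(f_E) = (n/p)·a_n(f)`
  have hE : ∀ n : ℕ, cuspCoeff fE n = (legendreSym p (n : ℤ) : ℂ) * cuspCoeff f n := by
    intro n
    rw [hfE.2 n, intCast_LFunction_eq_jacobiChar_mul_cuspCoeff p hp4 V W hVW hadd hfV n,
      jacobiChar_natCast, ← jacobiSym.legendreSym.to_jacobiSym]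
  -- the Legendre character and the continuation of `L(f', χ_p, s)`
  obtain ⟨hχ1, hχq, hχprim⟩ := jacobiChar_prime_ne_one_isQuadratic_isPrimitive p hp2
  have hχe := jacobiChar_even_of_mod_four_eq_one p hp4
  set χ := jacobiChar p with hχdef
  obtain ⟨L₂, hL₂d, hL₂⟩ := exists_differentiable_eq_twistedLSeries_holds f' χ
  -- the product `L(E,s)·L₂(s)` continues `L(f_E × 𝟙_K, s)` (Artin + coefficient relations)
  have hΛeq : ∀ s : ℂ, 2 < s.re →
      W.entireLFunction s * L₂ s = rankinSelbergEulerProductHecke fE (1 : HeckeCharacter K) s := by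
    intro s hs
    rw [hArt.trivial K h2 κ hκ hκ2 fE hfE.1 hs, W.entireLFunction_eq_LSeries hEnt (by linarith),
      hL₂ s hs]
    congr 1
    · rw [LSeries_eq_twistedLSeries_of_coeff W fE (1 : DirichletCharacter ℂ 1) (fun n ↦ by
        rw [MulChar.one_apply (isUnit_of_subsingleton _), one_mul, hfE.2 n])]
    · unfold twistedLSeries
      refine LSeries_congr (fun {n} _ ↦ ?_) s
      rw [dirichletCharacter_mul_natCast, MulChar.one_apply (isUnit_of_subsingleton _), one_mul,
        hV' n, hE n, hχdef, jacobiChar_natCast, ← jacobiSym.legendreSym.to_jacobiSym]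
      ring
  have hΛd : Differentiable ℂ (fun s ↦ W.entireLFunction s * L₂ s) :=
    (W.differentiable_entireLFunction hEnt).mul hL₂d
  have hA := hArch (fun s ↦ W.entireLFunction s * L₂ s) hΛd hΛeq
  have hL0 : W.entireLFunction 1 = 0 := entireLFunction_one_eq_zero_of_analyticRank_eq_one hr
  have hderiv : deriv (fun s ↦ W.entireLFunction s * L₂ s) 1 = deriv W.entireLFunction 1 * L₂ 1 := by
    rw [deriv_fun_mul (W.differentiable_entireLFunction hEnt 1) (hL₂d 1), hL0, zero_mul, add_zero]
  rw [hderiv, hcL] at hA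
  -- Birch for `f'` at `χ_p`: `S'·Ω⁺_{f'} = τ·L₂(1)`, `τ² = p`
  have hBirch := ratTwistedSymbolSum_mul_plusPeriod_holds hfV'.1 hfV'.coeffField_eq_bot hχprim hχe hL₂d
    (fun s hs ↦ by rw [hχq.inv]; exact hL₂ s hs)
  rw [← cast_legendrePlusSymbolSum_eq_ratTwistedSymbolSum p f'] at hBirch
  set τ : ℂ := gaussSum χ (ZMod.stdAddChar (N := p)) with hτdef
  have hτsq : τ ^ 2 = (p : ℂ) := by
    rw [hτdef, gaussSum_sq hχ1 hχq (ZMod.isPrimitive_stdAddChar p), hχe, one_mul, ZMod.card]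
  have hsqrt : ((Real.sqrt p : ℝ) : ℂ) ^ 2 = (p : ℂ) := by
    rw [← Complex.ofReal_pow, Real.sq_sqrt (Nat.cast_nonneg p)]
    push_cast
    rfl
  -- `τ·√p = ε·p`, `ε = ±1`
  obtain ⟨ε, hε, hτp⟩ : ∃ ε : ℚ, (ε = 1 ∨ ε = -1) ∧ τ * (Real.sqrt p : ℂ) = (ε : ℂ) * (p : ℂ) := by
    have h0 : (τ + (Real.sqrt p : ℂ)) * (τ - (Real.sqrt p : ℂ)) = 0 := by
      rw [← sq_sub_sq, hτsq, hsqrt, sub_self]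
    rcases mul_eq_zero.mp h0 with h | h
    · refine ⟨-1, Or.inr rfl, ?_⟩
      rw [eq_neg_of_add_eq_zero_left h, neg_mul, ← sq, hsqrt]
      push_cast
      ring
    · refine ⟨1, Or.inl rfl, ?_⟩
      rw [sub_eq_zero.mp h, ← sq, hsqrt]
      push_cast
      ring
  -- Pal: `√p·Ω_E = Ω_V`, and `ϖ·Ω_V = Ω⁺_f`
  have hPal' : Real.sqrt p * W.realPeriodRat = V.realPeriodRat := hPal V W p hp4 hsemi hVW
  have hΩf : ((plusPeriod f : ℝ) : ℂ) = (ϖ : ℂ) * (Real.sqrt p : ℝ) * (W.realPeriodRat : ℝ) := by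
    rw [← hϖ, ← hPal']
    push_cast
    ring
  -- non-vanishing
  have hΩW : ((W.realPeriodRat : ℝ) : ℂ) ≠ 0 := by exact_mod_cast W.realPeriodRat_pos_holds.ne'
  have hΩf' : ((plusPeriod f' : ℝ) : ℂ) ≠ 0 := by
    exact_mod_cast (IsNewform0.plusPeriod_pos_holds hfV'.1 hfV'.coeffField_eq_bot).ne'
  have hR : ((W.regulator : ℝ) : ℂ) ≠ 0 := by exact_mod_cast (W.regulator_pos_holds).ne'
  have hS'c : ((legendrePlusSymbolSum f' p : ℚ) : ℂ) ≠ 0 := by exact_mod_cast hS'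
  have hqc : (q : ℂ) ≠ 0 := by exact_mod_cast hq
  have hcc : (c : ℂ) ≠ 0 := by exact_mod_cast hc
  have hCarc : ((Car : ℝ) : ℂ) ≠ 0 := by exact_mod_cast hCar.ne'
  -- the real identity in `ℂ`
  have hρR' : ((P₁.heightPairing P₂ / 2 : ℝ) : ℂ) = (ρ : ℂ) * (W.regulator : ℂ) := by
    rw [hρR]; push_cast; ring
  rw [hρR'] at hA
  push_cast at hA
  obtain ⟨hρ, hX⟩ := arch_algebra (u := splitLocalConstant p) hA hBirch hτp hΩf hR hΩW hqc hcc hS'c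
    hCarc hΩf'
  exact ⟨hρ, ε, hε, hX⟩

/-! ### §3 STEP C(2b): the `p`-adic side for `α = a_p(V) = ±1` -/

omit [W.IsElliptic] [W.IsGloballyMinimal] [IsGalois ℚ K] in
/-- **STEP C(2b) — the `p`-adic side at a MULTIPLICATIVE twist model: Theorem B ÷ (rational `X`) is the
branch identity.** From the Theorem-B clause with `α = a = a_p(V) = ±1`, the descended pairing
`⟨P₁,P₂⟩_{DhK} = ρ·Reg_p`, STEP B(2)'s coefficient `[T¹]G = X·[T¹]L⁺_p(f,a,…)·L⁺_p(f′,a,…)(0)` with `X`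
rational, `L⁺_p(f′,a,…)(0) = a⁻¹S′` and `Z° = u·p·a⁻²`: `ϖ·[T¹]L⁺_p(f,a,ω^{(p−1)/2},T)·log_p γ = u′·c·Reg_p`
with the unit `u′ = ±a⁻¹ = ±1` (gz's `padic_algebra`, verbatim).
[cite: Disegni2017, Theorem B (arXiv v3 PDF p. 9)] [cite: MazurTateTeitelbaum1986Invent, §I.10 (10.1), §I.14] -/
theorem padicRatioClause_identity_mult (hp4 : p % 4 = 1) (V : WeierstrassCurve ℚ) [V.IsElliptic]
    [V.IsGloballyMinimal] (hV : Mult V p) {N : ℕ} [NeZero N] {f : CuspForm (Gamma0 N) 2}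
    (hfV : IsNewformOf V f)
    {G : PowerSeries ℂ_[p]} {DhK : PAdicHeightDataK W p K} {Dh : PAdicHeightData W p}
    {P₁ P₂ : (W.baseChange K).toAffine.Point} {q ρ c S' ϖ ε : ℚ} {σ₀ : ℤˣ} {X B₂ : ℂ_[p]}
    (hq : q ≠ 0) (hρ : ρ ≠ 0) (hc : c ≠ 0) (hS' : S' ≠ 0) (hε : ε = 1 ∨ ε = -1)
    (hPad : PAdicRatioClause W K ((V.LFunction p : ℤ) : ℚ_[p]) G DhK P₁ P₂ q σ₀)
    (hρp : DhK.pairing P₁ P₂ = (ρ : ℚ_[p]) * ((1 : ℕ) : ℚ_[p]) * padicRegulator Dh)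
    (hcoef : PowerSeries.coeff 1 G = X *
      algebraMap ℚ_[p] ℂ_[p] (PowerSeries.coeff 1
        (padicLFunctionPlusBranchMult f ((V.LFunction p : ℤ) : ℚ_[p]) (p / 2))) * B₂)
    (hB2 : B₂ = algebraMap ℚ_[p] ℂ_[p] ((((V.LFunction p : ℤ) : ℚ_[p]))⁻¹ * (S' : ℚ_[p])))
    (hX : X = algebraMap ℚ_[p] ℂ_[p]
      ((ε * (2 * splitLocalConstant p * ϖ * ρ * p / (q * c * S')) : ℚ) : ℚ_[p])) :
    ∃ u : ℤ_[p]ˣ, (ϖ : ℚ_[p]) *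
        PowerSeries.coeff 1 (padicLFunctionPlusBranchMult f ((V.LFunction p : ℤ) : ℚ_[p]) (p / 2)) *
        padicLog p (cyclotomicGenerator p) = ((u : ℤ_[p]) : ℚ_[p]) * (c : ℚ_[p]) * padicRegulator Dh := by
  have hpP : p.Prime := hp.out
  set α : ℚ_[p] := ((V.LFunction p : ℤ) : ℚ_[p]) with hαdef
  set B₁ := padicLFunctionPlusBranchMult f α (p / 2) with hB₁
  set ℓγ : ℚ_[p] := padicLog p (cyclotomicGenerator p) with hℓγ
  -- Theorem B in `ℚ_p`
  rw [padicRatioClause_iff, hρp, hcoef, hB2, hX, Nat.cast_one, mul_one] at hPad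
  have hPad' : (ρ : ℚ_[p]) * padicRegulator Dh =
      ((σ₀ : ℤ) : ℚ_[p]) * (q : ℚ_[p]) * ((zCircOne p α)⁻¹ * 2⁻¹ * ℓγ) *
        ((((ε * (2 * splitLocalConstant p * ϖ * ρ * p / (q * c * S'))) : ℚ) : ℚ_[p]) *
          PowerSeries.coeff 1 B₁ * (α⁻¹ * (S' : ℚ_[p]))) := by
    apply (algebraMap ℚ_[p] ℂ_[p]).injective
    simp only [map_mul, map_ratCast, map_intCast, map_inv₀, map_ofNat] at hPad ⊢
    linear_combination hPad
  -- the root `a = ±1`: `a ≠ 0`, `a⁻¹ = ↑u₀`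
  obtain ⟨-, -, -, hα0⟩ := multRoot_spec V hV hfV
  obtain ⟨u₀, hu₀⟩ := exists_unit_coe_eq_inv_multRoot V hV hfV
  -- `Z° = u·p*·α⁻²`, `p* = p`
  have hpstar : (pStar p : ℚ_[p]) = (p : ℚ_[p]) := by
    rw [pStar, show (p - 1) / 2 = p / 2 by omega, neg_one_pow_half_eq_one_of_mod_four_eq_one p hp4]
    push_cast; ring
  have hu0 : (splitLocalConstant p : ℚ_[p]) ≠ 0 := by exact_mod_cast splitLocalConstant_ne_zero p
  have hpp : (p : ℚ_[p]) ≠ 0 := by exact_mod_cast hpP.ne_zero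
  have hqp : (q : ℚ_[p]) ≠ 0 := by exact_mod_cast hq
  have hcp' : (c : ℚ_[p]) ≠ 0 := by exact_mod_cast hc
  have hS'p : (S' : ℚ_[p]) ≠ 0 := by exact_mod_cast hS'
  have hρp' : (ρ : ℚ_[p]) ≠ 0 := by exact_mod_cast hρ
  -- the sign `σ₀·ε`
  have hσ₀ : ((σ₀ : ℤ) : ℚ_[p]) = 1 ∨ ((σ₀ : ℤ) : ℚ_[p]) = -1 := by
    rcases Int.units_eq_one_or σ₀ with h | h <;> simp [h]
  have hεp : (ε : ℚ_[p]) = 1 ∨ (ε : ℚ_[p]) = -1 := by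
    rcases hε with h | h <;> simp [h]
  have hs2 : (((σ₀ : ℤ) : ℚ_[p]) * (ε : ℚ_[p])) ^ 2 = 1 := by
    rcases hσ₀ with h | h <;> rcases hεp with h' | h' <;> rw [h, h'] <;> norm_num
  rw [zCircOne] at hPad'
  have key := padic_algebra hPad' hpstar hs2 hρp' hqp hcp' hS'p hu0 hα0 hpp
  -- package the unit
  have hsign : ((σ₀ : ℤ) : ℚ_[p]) * (ε : ℚ_[p]) = 1 ∨ ((σ₀ : ℤ) : ℚ_[p]) * (ε : ℚ_[p]) = -1 := by
    rcases hσ₀ with h | h <;> rcases hεp with h' | h' <;> rw [h, h'] <;> norm_num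
  rcases hsign with hs | hs
  · refine ⟨u₀, ?_⟩
    rw [key, hs, one_mul, hu₀]
  · refine ⟨-u₀, ?_⟩
    rw [key, hs, Units.val_neg, PadicInt.coe_neg, hu₀]
    ring

/-! ### §4 STEP C(2): the identity at `(V, f, ϖ)`, `V` MULTIPLICATIVE at `p`, even branch -/

/-- **STEP C(2), (M) twin — the twisted-branch `p`-adic Gross–Zagier identity at a MULTIPLICATIVE twist
model `(V, f, ϖ)` from Disegni's clauses, EVEN branch.** See the module docstring for the statement and the
computation (gz's `branchPAdicGrossZagier_identity_of_cycLine` with `α = a_p(V) = ±1` and the one-term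
branch `L⁺_p(f, a_p, ω^{(p−1)/2}, T)`).
[cite: Disegni2017, Theorem A (arXiv v3 PDF pp. 7–8), Theorem B (PDF p. 9), (1.1.3) (PDF pp. 4–5)]
[cite: GrossZagier1986, Thm. I.(7.3)] [cite: Pal2012, Thm. 3.2] [cite: MazurTateTeitelbaum1986Invent, §I.8 (8.6), §I.10 (10.1), §I.14] -/
theorem branchPAdicGrossZagierMult_identity_of_cycLine (hp4 : p % 4 = 1)
    (hArt : rankinSelbergEulerProductHecke_baseChangeDirichlet_eq) (h73 : GrossZagier1986_thm_I_7_3)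
    (hPal : Pal2012.thm32_sqrt_mul_realPeriodRat_twist_eq_of_prime_one_mod_four)
    (hmod : hasEntireLFunction_rat) (hGZK : rank_eq_analyticRank_of_analyticRank_le_one)
    -- the quadratic field and its character
    (h2 : Module.finrank ℚ K = 2) (κ : DirichletCharacter ℂ (NumberField.discr K).natAbs)
    (hκ : ∀ ℓ : ℕ, ℓ.Prime → ℓ ≠ 2 → κ ℓ = (jacobiSym (NumberField.discr K) ℓ : ℂ))
    (hκ2 : κ 2 = if NumberField.discr K % 8 = 1 then 1
        else if NumberField.discr K % 8 = 5 then -1 else 0)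
    (hpd : Nat.Coprime p (NumberField.discr K).natAbs)
    (hrd : (W.quadraticTwist (NumberField.discr K : ℚ)).mordellWeilRank = 0)
    -- the curve, its multiplicative twist model, the twist by `κ`
    (hadd : Addv W p) (hr : W.analyticRank = 1)
    (V V' : WeierstrassCurve ℚ) [V.IsElliptic] [V.IsGloballyMinimal] [V'.IsElliptic] [V'.IsGloballyMinimal]
    (C : VariableChange ℚ) (hC : C • V.quadraticTwist (p : ℚ) = W) (hV : Mult V p) (hV'm : Mult V' p)
    (hap : V'.LFunction p = V.LFunction p)
    {N NE N' : ℕ} [NeZero N] [NeZero NE] [NeZero N'] {f : CuspForm (Gamma0 N) 2}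
    {fE : CuspForm (Gamma0 NE) 2} {f' : CuspForm (Gamma0 N') 2}
    (hfV : IsNewformOf V f) (hfE : IsNewformOf W fE) (hfV' : IsNewformOf V' f')
    (hV' : ∀ n : ℕ, cuspCoeff f' n = κ (n : ZMod (NumberField.discr K).natAbs) * cuspCoeff f n)
    (hS' : legendrePlusSymbolSum f' p ≠ 0)
    (ϖ : ℚ) (hϖ : (ϖ : ℝ) * V.realPeriodRat = plusPeriod f)
    -- the height data carrying Disegni's clauses
    {Dh : PAdicHeightData W p} {DhK : PAdicHeightDataK W p K} (hres : DhK.RestrictsToWith Dh 1)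
    (hGZc : CycLineGrossZagierClauses W K ι fE ((V.LFunction p : ℤ) : ℚ_[p]) DhK) :
    ∃ (u : ℤ_[p]ˣ) (q : ℚ),
      W.leadingLCoeff = (q : ℂ) * (W.realPeriodRat : ℂ) * (W.regulator : ℂ) ∧
      (ϖ : ℚ_[p]) *
          PowerSeries.coeff 1 (padicLFunctionPlusBranchMult f ((V.LFunction p : ℤ) : ℚ_[p]) (p / 2)) *
          padicLog p (cyclotomicGenerator p) =
        ((u : ℤ_[p]) : ℚ_[p]) * (q : ℚ_[p]) * padicRegulator Dh := by
  haveI : NeZero p := ⟨hp.out.ne_zero⟩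
  have hp2 : p ≠ 2 := by omega
  have hVW : ∃ C : VariableChange ℚ, C • V.quadraticTwist (p : ℚ) = W := ⟨C, hC⟩
  -- unpack Disegni's clauses
  obtain ⟨Car, hCar, G, hG, P₁, P₂, q, σ₀, hq, hArch, hPad⟩ := hGZc
  -- STEP B(2) on (M): `[T¹]G = c_p·[T¹]B_f·B_{f'}(0)`
  have hE : ∀ n : ℕ, cuspCoeff fE n = (legendreSym p (n : ℤ) : ℂ) * cuspCoeff f n := by
    intro n
    rw [hfE.2 n, intCast_LFunction_eq_jacobiChar_mul_cuspCoeff p hp4 V W hVW hadd hfV n,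
      jacobiChar_natCast, ← jacobiSym.legendreSym.to_jacobiSym]
  have hB0 : PowerSeries.constantCoeff
      (padicLFunctionPlusBranchMult f ((V.LFunction p : ℤ) : ℚ_[p]) (p / 2)) = 0 :=
    constantCoeff_plusBranchMult_eq_zero_of_analyticRank_eq_one hmod hadd hr hp4 V C hC hV hfV ϖ hϖ
  have hcoef := coeff_one_cycLine_eq_mult ι K hp4 hArt h2 κ hκ hκ2 hpd V V' hV hV'm hap hfV hfE.1 hfV'
    hE hV' hG hB0
  have hB2 : algebraMap ℚ_[p] ℂ_[p]
      (PowerSeries.constantCoeff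
        (padicLFunctionPlusBranchMult f' ((V'.LFunction p : ℤ) : ℚ_[p]) (p / 2))) =
      algebraMap ℚ_[p] ℂ_[p] ((((V.LFunction p : ℤ) : ℚ_[p]))⁻¹ *
        (legendrePlusSymbolSum f' p : ℚ_[p])) := by
    rw [constantCoeff_padicLFunctionPlusBranchMult_half_of_mult hp2 V' hV'm hfV', hap]
  -- STEP C(1): one rational `ρ`
  have hrk : W.mordellWeilRank = 1 := by rw [(hGZK W (by rw [hr])).1, hr]
  obtain ⟨ρ, hρR, hρp⟩ := exists_rat_heightPairing_eq_and_pairing_eq K h2 hrk hrd hres P₁ P₂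
  rw [h2] at hρR
  -- Gross–Zagier I.(7.3): `L'(E,1) = c·Ω_E·Reg_∞`
  obtain ⟨hlead, -⟩ := leadingLCoeff_eq_deriv_of_analyticRank_eq_one hr
  obtain ⟨c, hc, hcL⟩ := leadingLCoeff_eq_rat_mul_of_analyticRank_eq_one h73 hr hrk
  rw [hlead] at hcL
  -- (2a) the archimedean side: `X` is rational
  obtain ⟨hρ, ε, hε, hX⟩ := archRatioClause_rational_semistable K hp4 hArt hPal hmod h2 κ hκ hκ2 hadd hr
    V V' hVW (Or.inr hV) hfV hfE hfV' hV' hS' ϖ hϖ hc hcL hCar hq hArch hρR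
  have hXp : ((ι.symm ((splitLocalConstant p : ℂ) * (Car : ℂ) * (plusPeriod f : ℂ) *
      (plusPeriod f' : ℂ)) : PadicAlgCl p) : ℂ_[p]) = algebraMap ℚ_[p] ℂ_[p]
      ((ε * (2 * splitLocalConstant p * ϖ * ρ * p / (q * c * legendrePlusSymbolSum f' p)) : ℚ) :
        ℚ_[p]) := by
    rw [hX, coe_symm_ratCast, map_ratCast]
  -- (2b) the `p`-adic side
  obtain ⟨u, hu⟩ := padicRatioClause_identity_mult K hp4 V hV hfV hq hρ hc hS' hε hPad hρp hcoef hB2 hXp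
  exact ⟨u, c, by rw [hlead, hcL]; push_cast; ring, hu⟩

end Identity

end Summit.BirchSwinnertonDyer.BirchSwinnertonDyer.Theorems.AdditiveBranchIMCMultLower

end
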